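import Summits.PneNP.PneNP.Theorems.SymmetryBudgetWindowCanoniserLabelsDefs

/-!
# Window canoniser, I′: there are only `2^{O(n)}` admissible labels

Route `PneNP/SymmetryBudget`, dichotomy `WindowBarrier` (stmt-PneNP-2145) / `NoHiddenOrder` (stmt-PneNP-14781);
companion of `…WindowCanoniserLabelsDefs.lean`.  **`WCan.card_admSet_le`**: `|admSet K n| ≤ 2^{(2K+3) n}` — the
FLATNESS of the label set, which makes the canonising circuit polynomial in `m = 2^{Θ(n)}`.  Proof: a label is
`(U, X, λ)` with `U, X ⊆ Fin n` (`4^n` choices) and `λ : Fin n → Fin (n+1)` of total bit-length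
`∑_v ⌊log₂(λ v + 1)⌋ ≤ K n`; grouping the `λ` by their bit-length vectors `e` (`WCan.card_vec_sum_le`: at most
`2^{B+n}` vectors `e : Fin n → ℕ` with `∑ e ≤ B`, by induction on `n`) and counting each group by
`∏_v 2^{e v} ≤ 2^B` gives `2^{2B+n}` height functions.  Mathlib only.
-/

-- `Summit.PneNP.PneNP.…` duplicates `PneNP` BY DESIGN (single-problem summit, D-0017 layout).
set_option linter.dupNamespace false

namespace Summit.PneNP.PneNP.Theorems

namespace WCan

open Finset

/-! ### Vectors of bounded sum -/

/-- The vectors `e : Fin n → ℕ` with entries `≤ B` and `∑ e ≤ B`. -/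
def vecSum (n B : ℕ) : Finset (Fin n → ℕ) :=
  (Fintype.piFinset fun _ : Fin n => range (B + 1)).filter fun e => ∑ i, e i ≤ B

/-- Membership in `vecSum`: it suffices that the sum is at most `B`. -/
theorem mem_vecSum {n B : ℕ} {e : Fin n → ℕ} : e ∈ vecSum n B ↔ ∑ i, e i ≤ B := by
  simp only [vecSum, mem_filter, Fintype.mem_piFinset, mem_range, and_iff_right_iff_imp]
  intro h i
  have : e i ≤ ∑ j, e j := Finset.single_le_sum (f := e) (fun _ _ => Nat.zero_le _) (mem_univ i)
  omega

/-- A geometric sum bound: `∑_{a ≤ B} 2^{B - a + c} < 2^{B + 1 + c}`. -/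
theorem sum_two_pow_sub_le (B c : ℕ) : ∑ a ∈ range (B + 1), 2 ^ (B - a + c) < 2 ^ (B + 1 + c) := by
  induction B with
  | zero =>
    rw [sum_range_one, Nat.sub_zero, Nat.zero_add, Nat.add_comm, pow_succ]
    have := Nat.two_pow_pos c
    omega
  | succ B ih =>
    rw [Finset.sum_range_succ', Nat.sub_zero]
    have : ∑ a ∈ range (B + 1), 2 ^ (B + 1 - (a + 1) + c) = ∑ a ∈ range (B + 1), 2 ^ (B - a + c) :=
      Finset.sum_congr rfl fun a _ => by rw [Nat.add_sub_add_right]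
    rw [this]
    have h2 : 2 ^ (B + 1 + 1 + c) = 2 ^ (B + 1 + c) + 2 ^ (B + 1 + c) := by
      rw [show B + 1 + 1 + c = (B + 1 + c) + 1 by ring, pow_succ]; ring
    omega

/-- **Stars and bars, crudely**: at most `2^{B+n}` vectors `e : Fin n → ℕ` have `∑ e ≤ B`. -/
theorem card_vecSum_le (n : ℕ) : ∀ B : ℕ, (vecSum n B).card ≤ 2 ^ (B + n) := by
  induction n with
  | zero =>
    intro B
    refine (card_le_one.2 fun a _ b _ => funext fun i => i.elim0).trans (Nat.one_le_two_pow)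
  | succ n ih =>
    intro B
    -- fibre over the first entry
    have hmap : ∀ e ∈ vecSum (n + 1) B, e 0 ∈ range (B + 1) := by
      intro e he
      rw [mem_vecSum, Fin.sum_univ_succ] at he
      rw [mem_range]; omega
    rw [card_eq_sum_card_fiberwise hmap]
    have hfib : ∀ a ∈ range (B + 1), ((vecSum (n + 1) B).filter fun e => e 0 = a).card ≤ 2 ^ (B - a + n) := by
      intro a ha
      refine le_trans ?_ (ih (B - a))
      refine Finset.card_le_card_of_injOn Fin.tail (fun e he => ?_) (fun e he e' he' h => ?_)
      · rw [mem_coe, mem_filter, mem_vecSum, Fin.sum_univ_succ] at he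
        rw [mem_coe, mem_vecSum]
        have : ∑ i : Fin n, Fin.tail e i = ∑ i : Fin n, e i.succ := rfl
        omega
      · rw [mem_coe, mem_filter] at he he'
        rw [← Fin.cons_self_tail e, ← Fin.cons_self_tail e', h, he.2, he'.2]
    calc ∑ a ∈ range (B + 1), ((vecSum (n + 1) B).filter fun e => e 0 = a).card
        ≤ ∑ a ∈ range (B + 1), 2 ^ (B - a + n) := sum_le_sum hfib
      _ ≤ 2 ^ (B + (n + 1)) := by
          have := sum_two_pow_sub_le B n
          rw [show B + (n + 1) = B + 1 + n by ring]; omega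

/-! ### Height functions of bounded bit-length -/

/-- The height functions of total bit-length at most `B`. -/
def lamSet (n B : ℕ) : Finset (Fin n → Fin (n + 1)) := univ.filter fun f => ∑ v, Nat.log 2 ((f v : ℕ) + 1) ≤ B

/-- At most `2^c` numbers `x ≤ n` have `⌊log₂ (x+1)⌋ = c`. -/
theorem card_log_fibre_le (n c : ℕ) : (univ.filter fun x : Fin (n + 1) => Nat.log 2 ((x : ℕ) + 1) = c).card ≤ 2 ^ c := by
  have key : ∀ x : Fin (n + 1), Nat.log 2 ((x : ℕ) + 1) = c → 2 ^ c ≤ (x : ℕ) + 1 ∧ (x : ℕ) + 1 < 2 ^ (c + 1) := by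
    intro x hx
    have h1 := Nat.pow_log_le_self 2 (Nat.succ_ne_zero (x : ℕ))
    have h2 := Nat.lt_pow_succ_log_self (b := 2) one_lt_two ((x : ℕ) + 1)
    rw [hx] at h1 h2
    exact ⟨h1, h2⟩
  calc (univ.filter fun x : Fin (n + 1) => Nat.log 2 ((x : ℕ) + 1) = c).card
      ≤ (Finset.Ico (2 ^ c - 1) (2 ^ (c + 1) - 1)).card := by
        refine card_le_card_of_injOn (fun x => (x : ℕ)) (fun x hx => ?_) (fun x _ y _ h => Fin.ext h)
        rw [mem_coe, mem_filter] at hx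
        have h := key x hx.2
        have hc : 1 ≤ 2 ^ c := Nat.one_le_two_pow
        rw [mem_coe, mem_Ico]
        dsimp only
        omega
    _ ≤ 2 ^ c := by
        have hc : 1 ≤ 2 ^ c := Nat.one_le_two_pow
        rw [Nat.card_Ico, pow_succ]; omega

/-- **At most `2^{B+n} · 2^B` height functions have bit-length `≤ B`.** -/
theorem card_lamSet_le (n B : ℕ) : (lamSet n B).card ≤ 2 ^ (B + n) * 2 ^ B := by
  classical
  let prof : (Fin n → Fin (n + 1)) → (Fin n → ℕ) := fun f v => Nat.log 2 ((f v : ℕ) + 1)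
  have hmap : ∀ f ∈ lamSet n B, prof f ∈ vecSum n B := by
    intro f hf
    rw [mem_vecSum]
    exact (mem_filter.1 hf).2
  rw [card_eq_sum_card_fiberwise hmap]
  have hfib : ∀ e ∈ vecSum n B, ((lamSet n B).filter fun f => prof f = e).card ≤ 2 ^ B := by
    intro e he
    rw [mem_vecSum] at he
    calc ((lamSet n B).filter fun f => prof f = e).card
        ≤ (Fintype.piFinset fun v => univ.filter fun x : Fin (n + 1) => Nat.log 2 ((x : ℕ) + 1) = e v).card := by
          refine card_le_card fun f hf => ?_
          rw [mem_filter] at hf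
          rw [Fintype.mem_piFinset]
          intro v
          rw [mem_filter]
          exact ⟨mem_univ _, congrFun hf.2 v⟩
      _ = ∏ v, (univ.filter fun x : Fin (n + 1) => Nat.log 2 ((x : ℕ) + 1) = e v).card := Fintype.card_piFinset _
      _ ≤ ∏ v, 2 ^ e v := prod_le_prod' fun v _ => card_log_fibre_le n (e v)
      _ = 2 ^ ∑ v, e v := (Finset.prod_pow_eq_pow_sum _ _ _)
      _ ≤ 2 ^ B := Nat.pow_le_pow_right two_pos he
  calc ∑ e ∈ vecSum n B, ((lamSet n B).filter fun f => prof f = e).card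
      ≤ ∑ e ∈ vecSum n B, 2 ^ B := sum_le_sum hfib
    _ = (vecSum n B).card * 2 ^ B := by rw [sum_const, smul_eq_mul]
    _ ≤ 2 ^ (B + n) * 2 ^ B := Nat.mul_le_mul_right _ (card_vecSum_le n B)

/-! ### Admissible labels -/

/-- **Flatness of the label set: `|admSet K n| ≤ 2^{(2K+3) n}`.** -/
theorem card_admSet_le (K n : ℕ) : (RawLab.admSet K n).card ≤ 2 ^ ((2 * K + 3) * n) := by
  classical
  have hsub : RawLab.admSet K n ⊆ ((univ : Finset (Finset (Fin n))) ×ˢ ((univ : Finset (Finset (Fin n))) ×ˢ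
      lamSet n (K * n))).image fun t => ⟨t.1, t.2.1, t.2.2⟩ := by
    intro L hL
    rw [RawLab.mem_admSet] at hL
    rw [mem_image]
    refine ⟨(L.U, L.X, L.lam), ?_, rfl⟩
    simp only [mem_product, mem_univ, true_and, lamSet, mem_filter]
    -- the sum over all vertices equals the sum over `X` (heights vanish off `X`)
    have : ∑ v, Nat.log 2 ((L.lam v : ℕ) + 1) = ∑ v ∈ L.X, Nat.log 2 ((L.lam v : ℕ) + 1) := by
      symm
      refine sum_subset (subset_univ _) fun v _ hv => ?_
      rw [hL.1 v hv]; simp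
    rw [this]; exact hL.2
  calc (RawLab.admSet K n).card ≤ _ := card_le_card hsub
    _ ≤ ((univ : Finset (Finset (Fin n))) ×ˢ ((univ : Finset (Finset (Fin n))) ×ˢ lamSet n (K * n))).card :=
        card_image_le
    _ = 2 ^ n * (2 ^ n * (lamSet n (K * n)).card) := by
        rw [card_product, card_product, card_univ, Fintype.card_finset, Fintype.card_fin]
    _ ≤ 2 ^ n * (2 ^ n * (2 ^ (K * n + n) * 2 ^ (K * n))) := by gcongr; exact card_lamSet_le n (K * n)
    _ = 2 ^ ((2 * K + 3) * n) := by rw [← pow_add, ← pow_add, ← pow_add]; ring_nf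

/-- **The number of admissible labels is at most `2^{(2K+3) n}`.** -/
theorem card_Lab_le (K n : ℕ) : Fintype.card (Lab K n) ≤ 2 ^ ((2 * K + 3) * n) := by
  rw [Lab.card_eq]; exact card_admSet_le K n

end WCan

end Summit.PneNP.PneNP.Theorems
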